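import Mathlib
import Literature.NumberTheory.Sieve.Maynard2016CoupledKernelW
import HarnessLib

/-!
# Maynard (2016), Lemma 7: absolute values for the weighted coupled kernel

Topic `Literature/NumberTheory/Sieve`; trunk AntSieve / parity (Maynard 2016 large-gaps ladder, named
fact `Literature.NumberTheory.Sieve.Maynard2016.Lemma7Tuple` of `Maynard2016Lemma7PerTuple.lean`).

J. Maynard, *Large gaps between primes*, Ann. of Math. (2) 183 (2016), 915–933 = arXiv:1408.5110,
§6 (proof of Lemma 6, "the expression is absolutely convergent", "`∏_p K_p ≪ (log x)^{O_k(1)}`";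
Lemma 7, display (6.32)).  The absolute-convergence layer of `Maynard2016CoupledKernel` rests on two
facts: `|term| = ` the term of the norm weights (`norm_coupledEulerTerm_eq`) and
`‖K_p(|weights|)‖ ≤ exp(C_k p^{-1-σ})` (`norm_coupledLocalFactor_normWeight_le`).  This file proves
both for the GENERAL denominator weight of `Maynard2016CoupledEulerW` / `Maynard2016CoupledKernelW`:
`ofReal_norm_coupledSummandW`, `norm_coupledEulerTermW_eq` (the norm weight of `w` is `n ↦ ‖w n‖`,
again multiplicative: `IsPrimeProdMult.norm`), and **`norm_coupledLocalFactorW_normWeight_le`**: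
`‖K^v_p(|weights|)‖ ≤ exp(2 C_k p^{-1-σ})` whenever `‖v(p)‖ ≤ 2/p` (e.g. `v = ‖1/φ‖`,
`PolymathLcmSumsEuler.isLcmWeight_totient_inv`), `C_k = 3k₁ + 3k₂ + 9k₁k₂`.

## References

* J. Maynard, *Large gaps between primes*, Ann. of Math. (2) 183 (2016), 915–933; arXiv:1408.5110,
  §6, (6.9)–(6.11) and (6.32). [Maynard2016LargeGaps]
* D. H. J. Polymath, *Variants of the Selberg sieve, and bounded intervals containing many primes*,
  Res. Math. Sci. 1 (2014), Lemma 4.1 (last paragraph of the proof). [Polymath8b2014]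
-/

noncomputable section

open Finset ArithmeticFunction
open scoped BigOperators Classical

namespace Literature.NumberTheory.Sieve

namespace LcmEuler

variable {ι κ : Type*} [Fintype ι] [DecidableEq ι] [Fintype κ] [DecidableEq κ]

/-! ### Norms of the weighted terms -/

omit [DecidableEq ι] [DecidableEq κ] in
/-- `|coupledSummandW g h g' h' w| = coupledSummandW |g| |h| |g'| |h'| |w|` (as a complex number).
[cite: Maynard2016LargeGaps, §6 (proof of Lemma 6, "the expression is absolutely convergent")] -/
theorem ofReal_norm_coupledSummandW (g h : ι → ℕ → ℂ) (g' h' : κ → ℕ → ℂ) (w : ℕ → ℂ)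
    (tD : (ι → ℕ) × (ι → ℕ)) (tE : (κ → ℕ) × (κ → ℕ)) :
    ((‖coupledSummandW g h g' h' w tD tE‖ : ℝ) : ℂ) =
      coupledSummandW (normWeight g) (normWeight h) (normWeight g') (normWeight h')
        (fun n => ((‖w n‖ : ℝ) : ℂ)) tD tE := by
  rw [coupledSummandW, coupledSummandW, norm_mul, norm_mul, norm_prod, norm_prod]
  simp only [norm_mul, normWeight]
  push_cast
  rfl

omit [DecidableEq ι] [DecidableEq κ] in
/-- `|termW| =` the weighted term of the norm weights with the norm weight `‖w‖`, same admissibility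
indicator. [cite: Maynard2016LargeGaps, §6 (proof of Lemma 6, (6.9)–(6.11))] -/
theorem norm_coupledEulerTermW_eq (w : ℕ → ℂ) {W m : ℕ} {M : ℕ → Finset (ι × κ)} {a b : ι → ℂ}
    {a' b' : κ → ℂ} (t : ((ι → ℕ) × (ι → ℕ)) × ((κ → ℕ) × (κ → ℕ))) :
    ((‖coupledEulerTermW w W m M a b a' b' t‖ : ℝ) : ℂ) =
      if CoupledAdm W m M t.1 t.2 then
        coupledSummandW (normWeight (moebiusWeight a)) (normWeight (moebiusWeight b))
          (normWeight (moebiusWeight a')) (normWeight (moebiusWeight b'))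
          (fun n => ((‖w n‖ : ℝ) : ℂ)) t.1 t.2 else 0 := by
  unfold coupledEulerTermW
  split_ifs with hc
  · exact ofReal_norm_coupledSummandW _ _ _ _ _ _ _
  · simp

omit [Fintype ι] [DecidableEq ι] [Fintype κ] [DecidableEq κ] in
/-- The norm weight of an `IsLcmWeight` satisfies `‖·‖ ≤ 2/p` at primes and is multiplicative over
products of distinct primes. [cite: Polymath8b2014, Lemma 4.1 (last paragraph of the proof)] -/
theorem normWeight_of_isLcmWeight {w : ℕ → ℂ} (hw : IsLcmWeight w) :
    IsPrimeProdMult (fun n => ((‖w n‖ : ℝ) : ℂ)) ∧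
      ∀ p : ℕ, p.Prime → ‖(((‖w p‖ : ℝ) : ℂ))‖ ≤ 2 / p := by
  refine ⟨hw.mult.norm, fun p hp => ?_⟩
  rw [Complex.norm_real, Real.norm_eq_abs, abs_of_nonneg (norm_nonneg _)]
  exact hw.norm_le p hp

/-! ### The local factor of the norm weights -/

omit [Fintype ι] [DecidableEq ι] [Fintype κ] [DecidableEq κ] in
/-- `|μ(q) q^{-a}| ≤ q^{-σ} ≤ 1` at `q ≥ 1` when `Re a ≥ σ ≥ 0`. [folklore] -/
private theorem norm_moebiusWeight_le' {α : Type*} {a : α → ℂ} {σ : ℝ} (hσ : 0 ≤ σ)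
    (ha : ∀ i, σ ≤ (a i).re) (i : α) {q : ℕ} (hq : 1 ≤ q) :
    ‖moebiusWeight a i q‖ ≤ (q : ℝ) ^ (-σ) ∧ (q : ℝ) ^ (-σ) ≤ 1 := by
  have h := norm_moebius_mul_cpow_le q (a i)
  have hq1 : (1 : ℝ) ≤ q := by exact_mod_cast hq
  exact ⟨h.trans (Real.rpow_le_rpow_of_exponent_le hq1 (neg_le_neg (ha i))),
    Real.rpow_le_one_of_one_le_of_nonpos hq1 (by linarith)⟩

omit [Fintype ι] [DecidableEq ι] [Fintype κ] [DecidableEq κ] in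
/-- The local term of the norm weights is bounded by `3 q^{-σ}`. [folklore] -/
private theorem norm_slotTerm_normWeight_le' {α : Type*} {a b : α → ℂ} {σ : ℝ} (hσ : 0 ≤ σ)
    (ha : ∀ i, σ ≤ (a i).re) (hb : ∀ i, σ ≤ (b i).re) (i : α) {q : ℕ} (hq : 1 ≤ q) :
    ‖slotTerm (normWeight (moebiusWeight a)) (normWeight (moebiusWeight b)) q i‖ ≤
      3 * (q : ℝ) ^ (-σ) := by
  obtain ⟨h1, h1'⟩ := norm_moebiusWeight_le' hσ ha i hq
  obtain ⟨h2, _⟩ := norm_moebiusWeight_le' hσ hb i hq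
  have h0 : 0 ≤ (q : ℝ) ^ (-σ) := Real.rpow_nonneg (Nat.cast_nonneg q) _
  rw [slotTerm, normWeight, normWeight]
  have e1 : ‖((‖moebiusWeight a i q‖ : ℝ) : ℂ)‖ = ‖moebiusWeight a i q‖ := by
    rw [Complex.norm_real, Real.norm_eq_abs, abs_of_nonneg (norm_nonneg _)]
  have e2 : ‖((‖moebiusWeight b i q‖ : ℝ) : ℂ)‖ = ‖moebiusWeight b i q‖ := by
    rw [Complex.norm_real, Real.norm_eq_abs, abs_of_nonneg (norm_nonneg _)]
  calc _ ≤ ‖((‖moebiusWeight a i q‖ : ℝ) : ℂ) * ((‖moebiusWeight b i q‖ : ℝ) : ℂ)‖ +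
        ‖((‖moebiusWeight a i q‖ : ℝ) : ℂ)‖ + ‖((‖moebiusWeight b i q‖ : ℝ) : ℂ)‖ :=
        (norm_add_le _ _).trans (add_le_add (norm_add_le _ _) le_rfl)
    _ = ‖moebiusWeight a i q‖ * ‖moebiusWeight b i q‖ + ‖moebiusWeight a i q‖ +
        ‖moebiusWeight b i q‖ := by rw [norm_mul, e1, e2]
    _ ≤ (q : ℝ) ^ (-σ) * 1 + (q : ℝ) ^ (-σ) + (q : ℝ) ^ (-σ) := by
        have hb1 : ‖moebiusWeight b i q‖ ≤ 1 := h2.trans h1'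
        gcongr
    _ = 3 * (q : ℝ) ^ (-σ) := by ring

omit [DecidableEq ι] [DecidableEq κ] in
/-- **`K^v_p = 1 + O_k(p^{-1-σ})` for the absolute weighted local factor**: if `‖v(p)‖ ≤ 2/p` then
`‖K^v_p(|weights|)‖ ≤ 1 + 2(3k₁ + 3k₂ + 9k₁k₂) p^{-1-σ} ≤ exp(2(3k₁ + 3k₂ + 9k₁k₂) p^{-1-σ})`
("this modification may be absorbed into the `1 + O(1/p²)` factor").
[cite: Maynard2016LargeGaps, §6 display (6.11) and Lemma 7 display (6.32)] -/
theorem norm_coupledLocalFactorW_normWeight_le {a b : ι → ℂ} {a' b' : κ → ℂ} {σ : ℝ} (hσ : 0 ≤ σ)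
    (hab : ∀ i, σ ≤ (a i).re ∧ σ ≤ (b i).re) (hab' : ∀ j, σ ≤ (a' j).re ∧ σ ≤ (b' j).re)
    (v : ℕ → ℂ) (m : ℕ) (M : ℕ → Finset (ι × κ)) {q : ℕ} (hq : 1 ≤ q) (hv : ‖v q‖ ≤ 2 / q) :
    ‖coupledLocalFactorW (normWeight (moebiusWeight a)) (normWeight (moebiusWeight b))
        (normWeight (moebiusWeight a')) (normWeight (moebiusWeight b')) v m M q‖ ≤
      Real.exp (2 * (3 * Fintype.card ι + 3 * Fintype.card κ + 9 * Fintype.card ι * Fintype.card κ) *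
        (q : ℝ) ^ (-(1 + σ))) := by
  set C : ℝ := 3 * Fintype.card ι + 3 * Fintype.card κ + 9 * Fintype.card ι * Fintype.card κ with hC
  have hC0 : 0 ≤ C := by rw [hC]; positivity
  have hq0 : (0 : ℝ) < q := by exact_mod_cast hq
  have hpow0 : 0 ≤ (q : ℝ) ^ (-σ) := Real.rpow_nonneg hq0.le _
  have hpow1 : (q : ℝ) ^ (-σ) ≤ 1 := Real.rpow_le_one_of_one_le_of_nonpos (by exact_mod_cast hq) (by linarith)
  have hA : ∀ i, ‖slotTerm (normWeight (moebiusWeight a)) (normWeight (moebiusWeight b)) q i‖ ≤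
      3 * (q : ℝ) ^ (-σ) := fun i => norm_slotTerm_normWeight_le' hσ (fun i => (hab i).1) (fun i => (hab i).2) i hq
  have hB : ∀ j, ‖slotTerm (normWeight (moebiusWeight a')) (normWeight (moebiusWeight b')) q j‖ ≤
      3 * (q : ℝ) ^ (-σ) := fun j => norm_slotTerm_normWeight_le' hσ (fun j => (hab' j).1) (fun j => (hab' j).2) j hq
  -- the three pieces
  have hSA : ‖∑ i, slotTerm (normWeight (moebiusWeight a)) (normWeight (moebiusWeight b)) q i‖ ≤
      Fintype.card ι * (3 * (q : ℝ) ^ (-σ)) := by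
    refine (norm_sum_le _ _).trans ?_
    calc _ ≤ ∑ _i : ι, 3 * (q : ℝ) ^ (-σ) := Finset.sum_le_sum fun i _ => hA i
      _ = _ := by rw [Finset.sum_const, Finset.card_univ, nsmul_eq_mul]
  have hSB : ‖∑ j, slotTerm (normWeight (moebiusWeight a')) (normWeight (moebiusWeight b')) q j‖ ≤
      Fintype.card κ * (3 * (q : ℝ) ^ (-σ)) := by
    refine (norm_sum_le _ _).trans ?_
    calc _ ≤ ∑ _j : κ, 3 * (q : ℝ) ^ (-σ) := Finset.sum_le_sum fun j _ => hB j
      _ = _ := by rw [Finset.sum_const, Finset.card_univ, nsmul_eq_mul]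
  have hSM : ‖∑ p ∈ M q, slotTerm (normWeight (moebiusWeight a)) (normWeight (moebiusWeight b)) q p.1 *
      slotTerm (normWeight (moebiusWeight a')) (normWeight (moebiusWeight b')) q p.2‖ ≤
      Fintype.card ι * Fintype.card κ * (9 * (q : ℝ) ^ (-σ)) := by
    refine (norm_sum_le _ _).trans ?_
    have hle : ∀ p ∈ M q, ‖slotTerm (normWeight (moebiusWeight a)) (normWeight (moebiusWeight b)) q p.1 *
        slotTerm (normWeight (moebiusWeight a')) (normWeight (moebiusWeight b')) q p.2‖ ≤
        9 * (q : ℝ) ^ (-σ) := by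
      intro p _
      rw [norm_mul]
      calc _ ≤ (3 * (q : ℝ) ^ (-σ)) * (3 * (q : ℝ) ^ (-σ)) :=
          mul_le_mul (hA p.1) (hB p.2) (norm_nonneg _) (by positivity)
        _ ≤ (3 * (q : ℝ) ^ (-σ)) * (3 * 1) := by gcongr
        _ = 9 * (q : ℝ) ^ (-σ) := by ring
    calc _ ≤ ∑ _p ∈ M q, 9 * (q : ℝ) ^ (-σ) := Finset.sum_le_sum hle
      _ = (M q).card * (9 * (q : ℝ) ^ (-σ)) := by rw [Finset.sum_const, nsmul_eq_mul]
      _ ≤ _ := by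
          have hc : ((M q).card : ℝ) ≤ Fintype.card ι * Fintype.card κ := by
            have := Finset.card_le_card (Finset.subset_univ (M q))
            rw [Finset.card_univ, Fintype.card_prod] at this
            exact_mod_cast this
          gcongr
  -- assemble
  have hX : ‖(∑ i, slotTerm (normWeight (moebiusWeight a)) (normWeight (moebiusWeight b)) q i) +
      (if q ∣ m then 0 else
        (∑ j, slotTerm (normWeight (moebiusWeight a')) (normWeight (moebiusWeight b')) q j) +
        ∑ p ∈ M q, slotTerm (normWeight (moebiusWeight a)) (normWeight (moebiusWeight b)) q p.1 *
          slotTerm (normWeight (moebiusWeight a')) (normWeight (moebiusWeight b')) q p.2)‖ ≤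
      C * (q : ℝ) ^ (-σ) := by
    refine (norm_add_le _ _).trans ?_
    have hite : ‖(if q ∣ m then (0 : ℂ) else
        (∑ j, slotTerm (normWeight (moebiusWeight a')) (normWeight (moebiusWeight b')) q j) +
        ∑ p ∈ M q, slotTerm (normWeight (moebiusWeight a)) (normWeight (moebiusWeight b)) q p.1 *
          slotTerm (normWeight (moebiusWeight a')) (normWeight (moebiusWeight b')) q p.2)‖ ≤
        Fintype.card κ * (3 * (q : ℝ) ^ (-σ)) + Fintype.card ι * Fintype.card κ * (9 * (q : ℝ) ^ (-σ)) := by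
      split_ifs
      · rw [norm_zero]; positivity
      · exact (norm_add_le _ _).trans (add_le_add hSB hSM)
    calc _ ≤ Fintype.card ι * (3 * (q : ℝ) ^ (-σ)) + (Fintype.card κ * (3 * (q : ℝ) ^ (-σ)) +
          Fintype.card ι * Fintype.card κ * (9 * (q : ℝ) ^ (-σ))) := add_le_add hSA hite
      _ = C * (q : ℝ) ^ (-σ) := by rw [hC]; ring
  have hsplit : (q : ℝ) ^ (-(1 + σ)) = (q : ℝ) ^ (-σ) / q := by
    rw [neg_add, Real.rpow_add hq0, Real.rpow_neg_one, mul_comm, div_eq_mul_inv]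
  rw [coupledLocalFactorW]
  calc _ ≤ ‖(1 : ℂ)‖ + ‖v q * ((∑ i, slotTerm (normWeight (moebiusWeight a)) (normWeight (moebiusWeight b)) q i) +
      (if q ∣ m then 0 else
        (∑ j, slotTerm (normWeight (moebiusWeight a')) (normWeight (moebiusWeight b')) q j) +
        ∑ p ∈ M q, slotTerm (normWeight (moebiusWeight a)) (normWeight (moebiusWeight b)) q p.1 *
          slotTerm (normWeight (moebiusWeight a')) (normWeight (moebiusWeight b')) q p.2))‖ :=
        norm_add_le _ _
    _ ≤ 1 + 2 / q * (C * (q : ℝ) ^ (-σ)) := by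
        rw [norm_one, norm_mul]
        gcongr
    _ = 1 + 2 * C * (q : ℝ) ^ (-(1 + σ)) := by rw [hsplit]; ring
    _ ≤ Real.exp (2 * C * (q : ℝ) ^ (-(1 + σ))) := by
        rw [add_comm]; exact Real.add_one_le_exp _

end LcmEuler

end Literature.NumberTheory.Sieve

end
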